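import Summits.CriticalPhenomena.PercolationContinuityZ3.Theorems.PercAnnulusCrossingIICGluedAnnulusRegeneration
import Summits.CriticalPhenomena.PercolationContinuityZ3.Theorems.PercAnnulusCrossingIICOutsideDomination
import HarnessLib

/-!
# The outer cluster given the inside: quenched lower bounds for Kesten's IIC beyond a glued annulus under `CU⁺_l` (lane RSW3, p1 gen 19)

builds on p205010 (kernel theorem, internal audit signed; external expert review pending) — NOT used in this file.

RSW3 lane (LANE 3 `prim-rsw3`), seat `prim-rsw3-p1` (gen 19).  Helper file (`--supports stmt-CriticalPhenomena-4575`);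
no definitions, no sorries; every `d`, every `p`.  Memo `run/shared/lean/prim/rsw3/P1-QM.md` §32.

The regeneration lemma (gen 19 (1): on `U(a,la) ∩ {0 ↔ ∂ⁱⁿΛ(la)}` the far cluster of the origin is the outer cluster of the annulus),
the robust conditional annulus-uniqueness `CU⁺_l(c)` (`c·P(E) ≤ P(E ∩ U(a,la))` for increasing `E`; it survives conditioning on the
inside, gen 18 (9)) and Harris given the inside (gen 19 (2)) combine to the QUASI-RENEWAL INEQUALITY of P1-QM §31.8 (c):

* **`real_siteToBoundary_inter_inter_ge_of_outer`** — finite form: if `G` is increasing, read off `Λ(a−1)`, and on lattice configurations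
  `U(a,la) ∩ {0 ↔ ∂ⁱⁿΛ(la)} ∩ G ⊆ T`, then for every `D ∈ σ(Λ(a−1))` and `n ≥ la`: **`c · P(G) · P(A_n ∩ D) ≤ P(A_n ∩ D ∩ T)`**;
* **`iicMeasure_real_inter_ge_of_outer`** — IIC form: **`c · P_p(G) · ν(D) ≤ ν(D ∩ T)`** for cylinders `T` (every IIC measure `ν`): GIVEN ANYTHING
  INSIDE `Λ(a−1)`, every increasing functional of the far cluster of the IIC is at least `c_U ×` the same functional of the outer cluster of
  the annulus under plain Bernoulli percolation;
* **`iicMeasure_real_inter_openConnIn_ge`** — instance `T = {0 ↔ x in Λ(R)}`, `x ∉ Λ(la−1)`, `R ≥ la`: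
  **`c · P_p(x ↔ ∂ⁱⁿΛ(a) in Λ(R) ∖ Λ(a−1)) · ν(D) ≤ ν(D ∩ {0 ↔ x in Λ(R)})`**;
* **`iicMeasure_real_inter_openConnIn_ge_mul_tau`** — hence **`c · P_p(0 ↔ x in Λ(R)) · ν(D) ≤ ν(D ∩ {0 ↔ x in Λ(R)})`**: THE QUENCHED
  TWO-POINT FUNCTION OF THE IIC IS AT LEAST `c_U ×` THE FINITE-VOLUME TWO-POINT FUNCTION OF `P_p`, whatever the IIC does inside `Λ(a−1)`
  (gen 18 (13) had the `π`-form under (A2)□; here only `CU⁺_l` is used);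
* `iicMeasure_real_openConnIn_ge_mul_tau` — `D = univ`: `c · τ_p^{Λ(R)}(0,x) ≤ ν(0 ↔ x in Λ(R))`.
References: H. Kesten, Probab. Theory Relat. Fields 73 (1986) §2; G. Grimmett, *Percolation* (1999), Thm. (2.4); C. Garban, appendix to
Schramm–Smirnov, Ann. Probab. 39 (2011), Lemma B.1.
-/

noncomputable section

namespace Summit.CriticalPhenomena.PercolationContinuityZ3.Theorems.Crossing

open MeasureTheory Filter Topology Literature.Probability.Percolation Literature.Probability.LatticeModels
open Literature.Probability.Percolation.DCT16
open Summit.CriticalPhenomena.PercolationContinuityZ3.Theorems.SurfaceTension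

variable {d : ℕ}

/-! ## The quasi-renewal inequality, finite form -/

/-- **THE OUTER CLUSTER GIVEN THE INSIDE, finite `n`** (every `d`, `p`; `CU⁺_l(c)`, `l ≥ 2`, `a ≥ 1`).  Let `G` be increasing, measurable and
determined by a set of pairs disjoint from the pairs of `Λ(a−1)`, and let `T` be any event containing `U(a,la) ∩ {0 ↔ ∂ⁱⁿΛ(la)} ∩ G` on lattice
configurations.  Then for every measurable `D` determined by the pairs of `Λ(a−1)` and every `n ≥ la`:
**`c · P(G) · P({0 ↔ ∂ⁱⁿΛ(n)} ∩ D) ≤ P({0 ↔ ∂ⁱⁿΛ(n)} ∩ D ∩ T)`** (Harris given the inside, then the robust gluing given the inside, then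
regeneration). [cite: Kesten1986, §2] [cite: SchrammSmirnov2011, Appendix B, Lemma B.1] -/
theorem real_siteToBoundary_inter_inter_ge_of_outer (p : unitInterval) {l : ℕ} (hl : 2 ≤ l) {c : ℝ} (hc : 0 ≤ c)
    (hCU : ∀ a : ℕ, 1 ≤ a → ∀ E : Set (BondConfig (Site d)), IsUpperSet E → MeasurableSet E →
      c * (bondPercolation (zdGraph d) p).real E ≤ (bondPercolation (zdGraph d) p).real (E ∩
        {ω : BondConfig (Site d) | ∀ t ∈ innerBoundary (zdGraph d) (box d a), ∀ s ∈ innerBoundary (zdGraph d) (box d (l * a)),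
        ∀ t' ∈ innerBoundary (zdGraph d) (box d a), ∀ s' ∈ innerBoundary (zdGraph d) (box d (l * a)),
        ω ∈ openConnIn (↑((box d (l * a) \ box d a) ∪ innerBoundary (zdGraph d) (box d a)) : Set (Site d)) t s →
        ω ∈ openConnIn (↑((box d (l * a) \ box d a) ∪ innerBoundary (zdGraph d) (box d a)) : Set (Site d)) t' s' →
        ω ∈ openConnIn (↑((box d (l * a) \ box d a) ∪ innerBoundary (zdGraph d) (box d a)) : Set (Site d)) s s'}))
    {a n : ℕ} (ha : 1 ≤ a) (hn : l * a ≤ n) {D G T : Set (BondConfig (Site d))}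
    (hD : DeterminedBy D (↑((box d (a - 1)).sym2) : Set (Sym2 (Site d)))) (hDm : MeasurableSet D)
    (hG : IsUpperSet G) (hGm : MeasurableSet G) {K : Set (Sym2 (Site d))} (hGK : DeterminedBy G K)
    (hK : Disjoint K (↑((box d (a - 1)).sym2) : Set (Sym2 (Site d))))
    (hT : ∀ ω : BondConfig (Site d), ω ⊆ (zdGraph d).edgeSet →
      ω ∈ {ω : BondConfig (Site d) | ∀ t ∈ innerBoundary (zdGraph d) (box d a), ∀ s ∈ innerBoundary (zdGraph d) (box d (l * a)),
        ∀ t' ∈ innerBoundary (zdGraph d) (box d a), ∀ s' ∈ innerBoundary (zdGraph d) (box d (l * a)),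
        ω ∈ openConnIn (↑((box d (l * a) \ box d a) ∪ innerBoundary (zdGraph d) (box d a)) : Set (Site d)) t s →
        ω ∈ openConnIn (↑((box d (l * a) \ box d a) ∪ innerBoundary (zdGraph d) (box d a)) : Set (Site d)) t' s' →
        ω ∈ openConnIn (↑((box d (l * a) \ box d a) ∪ innerBoundary (zdGraph d) (box d a)) : Set (Site d)) s s'} →
      ω ∈ siteToBoundary d (l * a) → ω ∈ G → ω ∈ T) :
    c * (bondPercolation (zdGraph d) p).real G * (bondPercolation (zdGraph d) p).real (siteToBoundary d n ∩ D) ≤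
      (bondPercolation (zdGraph d) p).real (siteToBoundary d n ∩ D ∩ T) := by
  set μ := bondPercolation (zdGraph d) p with hμ
  set U : Set (BondConfig (Site d)) := {ω : BondConfig (Site d) | ∀ t ∈ innerBoundary (zdGraph d) (box d a), ∀ s ∈ innerBoundary (zdGraph d) (box d (l * a)),
        ∀ t' ∈ innerBoundary (zdGraph d) (box d a), ∀ s' ∈ innerBoundary (zdGraph d) (box d (l * a)),
        ω ∈ openConnIn (↑((box d (l * a) \ box d a) ∪ innerBoundary (zdGraph d) (box d a)) : Set (Site d)) t s →
        ω ∈ openConnIn (↑((box d (l * a) \ box d a) ∪ innerBoundary (zdGraph d) (box d a)) : Set (Site d)) t' s' →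
        ω ∈ openConnIn (↑((box d (l * a) \ box d a) ∪ innerBoundary (zdGraph d) (box d a)) : Set (Site d)) s s'} with hUdef
  have hla1 : 1 ≤ l * a := le_trans ha (Nat.le_mul_of_pos_left a (by omega))
  -- Harris given the inside: `P(G) · P(A_n ∩ D) ≤ P(A_n ∩ D ∩ G)`
  have h1 : μ.real G * μ.real (siteToBoundary d n ∩ D) ≤ μ.real (siteToBoundary d n ∩ D ∩ G) :=
    real_siteToBoundary_inter_inter_ge_mul p hD hDm hG hGm hGK hK
  -- robust gluing given the inside: `c · P((A_n ∩ G) ∩ D) ≤ P((A_n ∩ G) ∩ D ∩ U)`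
  have hUm : MeasurableSet U := measurableSet_of_isLocalEvent_holds (isLocalEvent_annulusUniq (d := d) (by nlinarith))
  have hUdet := determinedBy_annulusUniq (d := d) a (l * a) (sym2_annulus_subset_compl_sym2_box (d := d) (K := a - 1) (by omega))
  have hdisj : Disjoint {e : Sym2 (Site d) | e ∉ (↑((box d (a - 1)).sym2) : Set (Sym2 (Site d)))} (↑((box d (a - 1)).sym2)) :=
    Set.disjoint_left.2 fun e he he' => he he'
  have h2 : c * μ.real ((siteToBoundary d n ∩ G) ∩ D) ≤ μ.real ((siteToBoundary d n ∩ G) ∩ D ∩ U) :=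
    real_inter_inter_ge_of_robust p ((box d (a - 1)).sym2) hUm (fun ω ξ hξ => mem_iff_of_determinedBy_disjoint hUdet hdisj ω hξ)
      (fun E hE hEm => hCU a ha E hE hEm) ((isUpperSet_siteToBoundary d n).inter hG)
      ((measurableSet_siteToBoundary d n).inter hGm) hD hDm
  -- regeneration: `A_n ∩ G ∩ U ⊆ T` on lattice configurations (`n ≥ la`, so `A_n ⊆ A_{la}`)
  have h3 : μ.real ((siteToBoundary d n ∩ G) ∩ D ∩ U) ≤ μ.real (siteToBoundary d n ∩ D ∩ T) := by
    refine real_mono_of_forall_subset_edgeSet (zdGraph d) p fun ω hω h => ?_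
    obtain ⟨⟨⟨hA, hGω⟩, hDω⟩, hUω⟩ := h
    refine ⟨⟨hA, hDω⟩, hT ω hω hUω ?_ hGω⟩
    obtain ⟨y, hy, h0y⟩ := hA
    exact siteToBoundary_of_openConnIn_of_notMem hla1 hω
      (fun h' => notMem_box_of_mem_innerBoundary_box (by omega : l * a - 1 < n) hy h') h0y
  have hG0 : 0 ≤ μ.real G := measureReal_nonneg
  have hset : siteToBoundary d n ∩ D ∩ G = (siteToBoundary d n ∩ G) ∩ D := by
    ext ω; simp only [Set.mem_inter_iff]; tauto
  calc c * μ.real G * μ.real (siteToBoundary d n ∩ D)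
      = c * (μ.real G * μ.real (siteToBoundary d n ∩ D)) := by ring
    _ ≤ c * μ.real (siteToBoundary d n ∩ D ∩ G) := mul_le_mul_of_nonneg_left h1 hc
    _ = c * μ.real ((siteToBoundary d n ∩ G) ∩ D) := by rw [hset]
    _ ≤ μ.real ((siteToBoundary d n ∩ G) ∩ D ∩ U) := h2
    _ ≤ μ.real (siteToBoundary d n ∩ D ∩ T) := h3

/-! ## Under the IIC -/

/-- **THE OUTER CLUSTER GIVEN THE INSIDE, UNDER THE IIC** (every `d`, `p`; `CU⁺_l(c)`, `l ≥ 2`, `a ≥ 1`): with `G`, `T` as in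
`real_siteToBoundary_inter_inter_ge_of_outer` and `T` a cylinder event, for every finite measure `ν` with Kesten's IIC limit property and every
measurable `D` determined by the pairs of `Λ(a−1)`: **`c · P_p(G) · ν(D) ≤ ν(D ∩ T)`** — the quasi-renewal inequality: conditionally on
anything inside `Λ(a−1)`, an increasing functional of the far cluster of the IIC dominates `c ×` the same functional of the outer cluster of
the annulus under `P_p`. [cite: Kesten1986, §2] -/
theorem iicMeasure_real_inter_ge_of_outer (p : unitInterval) {l : ℕ} (hl : 2 ≤ l) {c : ℝ} (hc : 0 ≤ c)
    (hCU : ∀ a : ℕ, 1 ≤ a → ∀ E : Set (BondConfig (Site d)), IsUpperSet E → MeasurableSet E →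
      c * (bondPercolation (zdGraph d) p).real E ≤ (bondPercolation (zdGraph d) p).real (E ∩
        {ω : BondConfig (Site d) | ∀ t ∈ innerBoundary (zdGraph d) (box d a), ∀ s ∈ innerBoundary (zdGraph d) (box d (l * a)),
        ∀ t' ∈ innerBoundary (zdGraph d) (box d a), ∀ s' ∈ innerBoundary (zdGraph d) (box d (l * a)),
        ω ∈ openConnIn (↑((box d (l * a) \ box d a) ∪ innerBoundary (zdGraph d) (box d a)) : Set (Site d)) t s →
        ω ∈ openConnIn (↑((box d (l * a) \ box d a) ∪ innerBoundary (zdGraph d) (box d a)) : Set (Site d)) t' s' →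
        ω ∈ openConnIn (↑((box d (l * a) \ box d a) ∪ innerBoundary (zdGraph d) (box d a)) : Set (Site d)) s s'}))
    {ν : Measure (BondConfig (Site d))} [IsFiniteMeasure ν]
    (hν : ∀ (F : Finset (Sym2 (Site d))) (E : Set (BondConfig (Site d))), MeasurableSet E → DeterminedBy E ↑F →
      Tendsto (fun n : ℕ => (bondPercolation (zdGraph d) p).real (E ∩ siteToBoundary d n) / oneArmProb d p n)
        atTop (𝓝 (ν.real E)))
    {a : ℕ} (ha : 1 ≤ a) {D G T : Set (BondConfig (Site d))}
    (hD : DeterminedBy D (↑((box d (a - 1)).sym2) : Set (Sym2 (Site d)))) (hDm : MeasurableSet D)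
    (hG : IsUpperSet G) (hGm : MeasurableSet G) {K : Set (Sym2 (Site d))} (hGK : DeterminedBy G K)
    (hK : Disjoint K (↑((box d (a - 1)).sym2) : Set (Sym2 (Site d)))) (hTl : IsLocalEvent T)
    (hT : ∀ ω : BondConfig (Site d), ω ⊆ (zdGraph d).edgeSet →
      ω ∈ {ω : BondConfig (Site d) | ∀ t ∈ innerBoundary (zdGraph d) (box d a), ∀ s ∈ innerBoundary (zdGraph d) (box d (l * a)),
        ∀ t' ∈ innerBoundary (zdGraph d) (box d a), ∀ s' ∈ innerBoundary (zdGraph d) (box d (l * a)),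
        ω ∈ openConnIn (↑((box d (l * a) \ box d a) ∪ innerBoundary (zdGraph d) (box d a)) : Set (Site d)) t s →
        ω ∈ openConnIn (↑((box d (l * a) \ box d a) ∪ innerBoundary (zdGraph d) (box d a)) : Set (Site d)) t' s' →
        ω ∈ openConnIn (↑((box d (l * a) \ box d a) ∪ innerBoundary (zdGraph d) (box d a)) : Set (Site d)) s s'} →
      ω ∈ siteToBoundary d (l * a) → ω ∈ G → ω ∈ T) :
    c * (bondPercolation (zdGraph d) p).real G * ν.real D ≤ ν.real (D ∩ T) := by
  have hDloc : IsLocalEvent D := ⟨_, hD⟩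
  have hT1 := tendsto_iicMeasure_of_isLocalEvent p hν hDloc
  have hT2 := tendsto_iicMeasure_of_isLocalEvent p hν (hDloc.inter hTl)
  refine le_of_tendsto_of_tendsto (hT1.const_mul _) hT2 ?_
  rw [Filter.EventuallyLE, Filter.eventually_atTop]
  refine ⟨l * a, fun n hn => ?_⟩
  have h := real_siteToBoundary_inter_inter_ge_of_outer p hl hc hCU ha hn hD hDm hG hGm hGK hK hT
  show c * (bondPercolation (zdGraph d) p).real G * ((bondPercolation (zdGraph d) p).real (D ∩ siteToBoundary d n) / oneArmProb d p n) ≤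
    (bondPercolation (zdGraph d) p).real (D ∩ T ∩ siteToBoundary d n) / oneArmProb d p n
  by_cases hπ : oneArmProb d p n = 0
  · simp only [hπ, div_zero, mul_zero, le_refl]
  · have hπpos : 0 < oneArmProb d p n := lt_of_le_of_ne (by unfold oneArmProb; exact measureReal_nonneg) (Ne.symm hπ)
    rw [← mul_div_assoc, div_le_div_iff_of_pos_right hπpos]
    have h1 : D ∩ siteToBoundary d n = siteToBoundary d n ∩ D := Set.inter_comm _ _
    have h2 : D ∩ T ∩ siteToBoundary d n = siteToBoundary d n ∩ D ∩ T := by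
      ext ω; simp only [Set.mem_inter_iff]; tauto
    rw [h1, h2]
    exact h

/-! ## Instance: far points join the IIC with probability at least `c ×` Bernoulli -/

/-- **THE QUENCHED TWO-POINT FUNCTION, OUTER-CONNECTION FORM** (every `d`, `p`; `CU⁺_l(c)`, `l ≥ 2`, `1 ≤ a`, `la ≤ R`, `x ∉ Λ(la−1)`): for every
finite measure `ν` with Kesten's IIC limit property and every measurable `D` determined by the pairs of `Λ(a−1)`:
**`c · P_p(∃ t ∈ ∂ⁱⁿΛ(a), x ↔ t in Λ(R) ∖ Λ(a−1)) · ν(D) ≤ ν(D ∩ {0 ↔ x in Λ(R)})`**. [cite: Kesten1986, §2] -/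
theorem iicMeasure_real_inter_openConnIn_ge (p : unitInterval) {l : ℕ} (hl : 2 ≤ l) {c : ℝ} (hc : 0 ≤ c)
    (hCU : ∀ a : ℕ, 1 ≤ a → ∀ E : Set (BondConfig (Site d)), IsUpperSet E → MeasurableSet E →
      c * (bondPercolation (zdGraph d) p).real E ≤ (bondPercolation (zdGraph d) p).real (E ∩
        {ω : BondConfig (Site d) | ∀ t ∈ innerBoundary (zdGraph d) (box d a), ∀ s ∈ innerBoundary (zdGraph d) (box d (l * a)),
        ∀ t' ∈ innerBoundary (zdGraph d) (box d a), ∀ s' ∈ innerBoundary (zdGraph d) (box d (l * a)),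
        ω ∈ openConnIn (↑((box d (l * a) \ box d a) ∪ innerBoundary (zdGraph d) (box d a)) : Set (Site d)) t s →
        ω ∈ openConnIn (↑((box d (l * a) \ box d a) ∪ innerBoundary (zdGraph d) (box d a)) : Set (Site d)) t' s' →
        ω ∈ openConnIn (↑((box d (l * a) \ box d a) ∪ innerBoundary (zdGraph d) (box d a)) : Set (Site d)) s s'}))
    {ν : Measure (BondConfig (Site d))} [IsFiniteMeasure ν]
    (hν : ∀ (F : Finset (Sym2 (Site d))) (E : Set (BondConfig (Site d))), MeasurableSet E → DeterminedBy E ↑F →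
      Tendsto (fun n : ℕ => (bondPercolation (zdGraph d) p).real (E ∩ siteToBoundary d n) / oneArmProb d p n)
        atTop (𝓝 (ν.real E)))
    {a R : ℕ} (ha : 1 ≤ a) (hR : l * a ≤ R) {D : Set (BondConfig (Site d))}
    (hD : DeterminedBy D (↑((box d (a - 1)).sym2) : Set (Sym2 (Site d)))) (hDm : MeasurableSet D)
    {x : Site d} (hx : x ∉ box d (l * a - 1)) :
    c * (bondPercolation (zdGraph d) p).real {ω : BondConfig (Site d) | ∃ t ∈ innerBoundary (zdGraph d) (box d a),
        ω ∈ openConnIn ((↑(box d R) : Set (Site d)) \ ↑(box d (a - 1))) x t} * ν.real D ≤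
      ν.real (D ∩ openConnIn (↑(box d R) : Set (Site d)) 0 x) := by
  have hla : a < l * a := by nlinarith
  refine iicMeasure_real_inter_ge_of_outer p hl hc hCU hν ha hD hDm (isUpperSet_outerConn a _ x) (measurableSet_outerConn a _ x)
    (determinedBy_outerConn_compl a _ x) (Set.disjoint_left.2 fun e he he' => he he')
    ⟨(box d R).sym2, determinedBy_openConnIn _ 0 x (by rw [Finset.coe_sym2])⟩ ?_
  intro ω hω hU hA hG
  obtain ⟨t, ht, hxt⟩ := hG
  exact openConnIn_of_annulusUniq_of_siteToBoundary ha hla hω hU hA (Finset.coe_subset.2 (box_mono d hR)) hx ht hxt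

/-- **THE QUENCHED TWO-POINT FUNCTION OF THE IIC IS AT LEAST `c_U ×` THE BERNOULLI TWO-POINT FUNCTION** (every `d`, `p`; `CU⁺_l(c)`, `l ≥ 2`,
`1 ≤ a`, `la ≤ R`, `x ∉ Λ(la−1)`): for every finite measure `ν` with Kesten's IIC limit property and every measurable `D` determined by the pairs
of `Λ(a−1)`: **`c · P_p(0 ↔ x in Λ(R)) · ν(D) ≤ ν(D ∩ {0 ↔ x in Λ(R)})`** — whatever the IIC does inside `Λ(a−1)`, the far point `x` belongs
to it (inside `Λ(R)`) with conditional probability at least `c · τ_p^{Λ(R)}(0,x)`.  (A Bernoulli path from `0` to `x` in `Λ(R)` reaches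
`∂ⁱⁿΛ(a)` from `x` off `Λ(a−1)`.) [cite: Kesten1986, §2] -/
theorem iicMeasure_real_inter_openConnIn_ge_mul_tau (p : unitInterval) {l : ℕ} (hl : 2 ≤ l) {c : ℝ} (hc : 0 ≤ c)
    (hCU : ∀ a : ℕ, 1 ≤ a → ∀ E : Set (BondConfig (Site d)), IsUpperSet E → MeasurableSet E →
      c * (bondPercolation (zdGraph d) p).real E ≤ (bondPercolation (zdGraph d) p).real (E ∩
        {ω : BondConfig (Site d) | ∀ t ∈ innerBoundary (zdGraph d) (box d a), ∀ s ∈ innerBoundary (zdGraph d) (box d (l * a)),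
        ∀ t' ∈ innerBoundary (zdGraph d) (box d a), ∀ s' ∈ innerBoundary (zdGraph d) (box d (l * a)),
        ω ∈ openConnIn (↑((box d (l * a) \ box d a) ∪ innerBoundary (zdGraph d) (box d a)) : Set (Site d)) t s →
        ω ∈ openConnIn (↑((box d (l * a) \ box d a) ∪ innerBoundary (zdGraph d) (box d a)) : Set (Site d)) t' s' →
        ω ∈ openConnIn (↑((box d (l * a) \ box d a) ∪ innerBoundary (zdGraph d) (box d a)) : Set (Site d)) s s'}))
    {ν : Measure (BondConfig (Site d))} [IsFiniteMeasure ν]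
    (hν : ∀ (F : Finset (Sym2 (Site d))) (E : Set (BondConfig (Site d))), MeasurableSet E → DeterminedBy E ↑F →
      Tendsto (fun n : ℕ => (bondPercolation (zdGraph d) p).real (E ∩ siteToBoundary d n) / oneArmProb d p n)
        atTop (𝓝 (ν.real E)))
    {a R : ℕ} (ha : 1 ≤ a) (hR : l * a ≤ R) {D : Set (BondConfig (Site d))}
    (hD : DeterminedBy D (↑((box d (a - 1)).sym2) : Set (Sym2 (Site d)))) (hDm : MeasurableSet D)
    {x : Site d} (hx : x ∉ box d (l * a - 1)) :
    c * (bondPercolation (zdGraph d) p).real (openConnIn (↑(box d R) : Set (Site d)) 0 x) * ν.real D ≤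
      ν.real (D ∩ openConnIn (↑(box d R) : Set (Site d)) 0 x) := by
  have hala : a ≤ l * a := Nat.le_mul_of_pos_left a (by omega)
  have hxa : x ∉ box d (a - 1) := fun h' => hx (box_mono d (by omega) h')
  have hmono : (bondPercolation (zdGraph d) p).real (openConnIn (↑(box d R) : Set (Site d)) 0 x) ≤
      (bondPercolation (zdGraph d) p).real {ω : BondConfig (Site d) | ∃ t ∈ innerBoundary (zdGraph d) (box d a),
        ω ∈ openConnIn ((↑(box d R) : Set (Site d)) \ ↑(box d (a - 1))) x t} :=
    real_mono_of_forall_subset_edgeSet (zdGraph d) p fun ω hω h => exists_innerBoundary_openConnIn_sdiff_of_openConnIn ha hω hxa h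
  calc c * (bondPercolation (zdGraph d) p).real (openConnIn (↑(box d R) : Set (Site d)) 0 x) * ν.real D
      ≤ c * (bondPercolation (zdGraph d) p).real {ω : BondConfig (Site d) | ∃ t ∈ innerBoundary (zdGraph d) (box d a),
          ω ∈ openConnIn ((↑(box d R) : Set (Site d)) \ ↑(box d (a - 1))) x t} * ν.real D :=
        mul_le_mul_of_nonneg_right (mul_le_mul_of_nonneg_left hmono hc) measureReal_nonneg
    _ ≤ ν.real (D ∩ openConnIn (↑(box d R) : Set (Site d)) 0 x) := iicMeasure_real_inter_openConnIn_ge p hl hc hCU hν ha hR hD hDm hx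

/-- **UNCONDITIONAL FORM** (`D = univ`): under `CU⁺_l(c)`, for every finite measure `ν` with Kesten's IIC limit property, `la ≤ R` and
`x ∉ Λ(la−1)`: **`c · P_p(0 ↔ x in Λ(R)) · ν(univ) ≤ ν(0 ↔ x in Λ(R))`** — the IIC two-point function dominates `c_U ×` the Bernoulli one, with
no quasi-multiplicativity hypothesis. [cite: Kesten1986, §2] -/
theorem iicMeasure_real_openConnIn_ge_mul_tau (p : unitInterval) {l : ℕ} (hl : 2 ≤ l) {c : ℝ} (hc : 0 ≤ c)
    (hCU : ∀ a : ℕ, 1 ≤ a → ∀ E : Set (BondConfig (Site d)), IsUpperSet E → MeasurableSet E →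
      c * (bondPercolation (zdGraph d) p).real E ≤ (bondPercolation (zdGraph d) p).real (E ∩
        {ω : BondConfig (Site d) | ∀ t ∈ innerBoundary (zdGraph d) (box d a), ∀ s ∈ innerBoundary (zdGraph d) (box d (l * a)),
        ∀ t' ∈ innerBoundary (zdGraph d) (box d a), ∀ s' ∈ innerBoundary (zdGraph d) (box d (l * a)),
        ω ∈ openConnIn (↑((box d (l * a) \ box d a) ∪ innerBoundary (zdGraph d) (box d a)) : Set (Site d)) t s →
        ω ∈ openConnIn (↑((box d (l * a) \ box d a) ∪ innerBoundary (zdGraph d) (box d a)) : Set (Site d)) t' s' →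
        ω ∈ openConnIn (↑((box d (l * a) \ box d a) ∪ innerBoundary (zdGraph d) (box d a)) : Set (Site d)) s s'}))
    {ν : Measure (BondConfig (Site d))} [IsFiniteMeasure ν]
    (hν : ∀ (F : Finset (Sym2 (Site d))) (E : Set (BondConfig (Site d))), MeasurableSet E → DeterminedBy E ↑F →
      Tendsto (fun n : ℕ => (bondPercolation (zdGraph d) p).real (E ∩ siteToBoundary d n) / oneArmProb d p n)
        atTop (𝓝 (ν.real E)))
    {a R : ℕ} (ha : 1 ≤ a) (hR : l * a ≤ R) {x : Site d} (hx : x ∉ box d (l * a - 1)) :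
    c * (bondPercolation (zdGraph d) p).real (openConnIn (↑(box d R) : Set (Site d)) 0 x) * ν.real Set.univ ≤
      ν.real (openConnIn (↑(box d R) : Set (Site d)) 0 x) := by
  have h := iicMeasure_real_inter_openConnIn_ge_mul_tau p hl hc hCU hν ha hR (D := Set.univ)
    (Literature.Probability.Percolation.determinedBy_univ _) MeasurableSet.univ hx
  rwa [Set.univ_inter] at h

end Summit.CriticalPhenomena.PercolationContinuityZ3.Theorems.Crossing

end
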